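import Summits.RiemannHypothesis.RiemannHypothesis.Theorems.SignConeConeMagnificationTorusFiniteBoundary
import Summits.RiemannHypothesis.RiemannHypothesis.Theorems.SignConeConeMagnificationTorusFiniteMean

/-!
# `SignCone.ConeMagnification`, line `Sketch` (r3): the torus inequality for EVENTUALLY-`Λ` weights, III —
# assembly (crux stmt-RiemannHypothesis-16303; HELPER file, `--supports`; registered sub-goal
`torusOfCara_of_eventually_vonMangoldt`)

`torusOfCara_of_eventually_vonMangoldt` is the open core `stub_torusOfCara` of the crux skeleton
(`Cruxes/ConeMagnification/Lines/Sketch.lean`, r3) with ONE extra hypothesis, `∃ N, ∀ n ≥ N, c n = Λ n`: for such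
weights the Carathéodory majorant `Re (L_c − 1/(s−1)) ≤ 1/2 + Re(1/s) + ½Re ψ(s/2) − ½log π` on `re s > 1/2`
implies the torus inequality `Σ_{A⊆S} (c−Λ)(n_A) n_A^{-1/2} 2^{-|A|} cos(|A|φ) ≤ 1/2` for every finite set of
primes `S` and every phase `φ`.  This is the stub's MODEL argument made rigorous in the one regime where it is
rigorous — `P = L_{c−Λ}` a Dirichlet POLYNOMIAL, continuous on the critical line — and it covers every finitely
supported modification of `Λ` (the disprover's `SlackBall`, `Negative/SlackBall.lean`; it is the Carathéodory
half of the "K-criterion" predicted in `Cruxes/ConeMagnification/Disproof.lean` §C).  Parts: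
I (`…TorusFiniteBoundary.lean`): `Re P(1/2+it) ≤ 1/2` for all `t` (identity theorem + `Re ξ'/ξ = 0` on the line);
II (`…TorusFiniteMean.lean`): Bohr means against the resonator `|Σ_{A⊆S} e^{i|A|φ} n_A^{it}|²`;
here: the critical-line reading of a Dirichlet monomial and the composition.

What this does NOT touch: the general weight (the open core), where `L_{c−Λ}` need not extend continuously to the
line and the zeta atoms of the spectral measure intervene (see `SignConeConeMagnificationCalibration.lean` and the
seat-0 evidence note DIAGNOSIS-16303-s3.md).
-/

noncomputable section

set_option linter.dupNamespace false

open scoped BigOperators ComplexConjugate Topology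
open Complex Filter Set

namespace Summit.RiemannHypothesis.RiemannHypothesis.Theorems.SignConeConeMagnification

open Literature.NumberTheory.LFunctions ArithmeticFunction

/-! ## Assembly: the torus inequality for eventually-`Λ` weights -/

/-- On the critical line a Dirichlet monomial reads `Re (x · n^{-(1/2+it)}) = x n^{-1/2} cos(t log n)` (`n ≥ 1`,
`x` real). [folklore] -/
theorem re_ofReal_div_natCast_cpow_half_add (x t : ℝ) {n : ℕ} (hn : 1 ≤ n) :
    (((x : ℝ) : ℂ) / (n : ℂ) ^ ((1 / 2 : ℂ) + t * I)).re = x / Real.sqrt n * Real.cos (Real.log n * t) := by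
  have hn0 : (n : ℂ) ≠ 0 := by exact_mod_cast (show n ≠ 0 by omega)
  have hnpos : (0 : ℝ) < n := by exact_mod_cast (show 0 < n by omega)
  have hsqrt : Real.exp (Real.log n / 2) = Real.sqrt n := by
    rw [Real.sqrt_eq_rpow, Real.rpow_def_of_pos hnpos]
    congr 1
    ring
  have hcpow : (n : ℂ) ^ ((1 / 2 : ℂ) + t * I) =
      (Real.sqrt n : ℂ) * cexp (((Real.log n * t : ℝ) : ℂ) * I) := by
    rw [Complex.cpow_def_of_ne_zero hn0, ← Complex.natCast_log,
      show ((Real.log n : ℝ) : ℂ) * ((1 / 2 : ℂ) + t * I) =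
          ((Real.log n / 2 : ℝ) : ℂ) + ((Real.log n * t : ℝ) : ℂ) * I by push_cast; ring,
      Complex.exp_add, ← Complex.ofReal_exp, hsqrt]
  rw [hcpow, div_mul_eq_div_div, ← Complex.ofReal_div, div_eq_mul_inv, ← Complex.exp_neg, ← neg_mul,
    ← Complex.ofReal_neg, Complex.re_ofReal_mul, Complex.exp_ofReal_mul_I_re, Real.cos_neg]

/-- **The torus inequality of `stub_torusOfCara` for EVENTUALLY-`Λ` weights** (registered sub-goal
`torusOfCara_of_eventually_vonMangoldt`; the stub's signature with the extra hypothesis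
`∃ N, ∀ n ≥ N, c n = Λ n` — every finitely supported modification of `Λ`, e.g. the disprover's `SlackBall`).
From the Carathéodory majorant, `Re P(1/2+it) ≤ 1/2` on the whole critical line
(`re_dirichletPoly_critical_le_half`, part I), read as `Σ (c−Λ)(n) n^{-1/2} cos(t log n) ≤ 1/2`
(`re_ofReal_div_natCast_cpow_half_add`), and the Bohr-mean argument of part II
(`torusSum_le_half_of_re_le_half`) gives the torus inequality for every finite set of primes and every phase.
The hypotheses `0 ≤ c n`, `c 1 = 0` are not used. [folklore] -/
theorem torusOfCara_of_eventually_vonMangoldt :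
    ∀ c : ℕ → ℝ, (∀ n, 0 ≤ c n) → c 1 = 0 →
      (∀ σ : ℝ, 1 < σ → LSeriesSummable (fun n => ((c n : ℝ) : ℂ)) σ) →
      (∃ N : ℕ, ∀ n : ℕ, N ≤ n → c n = ArithmeticFunction.vonMangoldt n) →
      (∃ F : ℂ → ℂ, DifferentiableOn ℂ F {s : ℂ | 1 / 2 < s.re} ∧
        (∀ s : ℂ, 1 < s.re → F s = LSeries (fun n => ((c n : ℝ) : ℂ)) s - 1 / (s - 1)) ∧
        ∀ s : ℂ, 1 / 2 < s.re →
          (F s).re ≤ 1 / 2 + (1 / s).re + (Complex.digamma (s / 2)).re / 2 - Real.log Real.pi / 2) →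
      ∀ S : Finset ℕ, (∀ p ∈ S, p.Prime) → ∀ φ : ℝ,
        ∑ A ∈ S.powerset, (c (∏ p ∈ A, p) - ArithmeticFunction.vonMangoldt (∏ p ∈ A, p)) /
            Real.sqrt (∏ p ∈ A, (p : ℝ)) * (1 / 2) ^ A.card * Real.cos ((A.card : ℝ) * φ) ≤ 1 / 2 := by
  intro c _ _ hsum hev hF S hS φ
  obtain ⟨N, hN⟩ := hev
  have hN1 : 1 ≤ N + 1 := by omega
  have hNN : ∀ n, N + 1 ≤ n → c n = Λ n := fun n hn => hN n (by omega)
  have hline := re_dirichletPoly_critical_le_half c (N + 1) hNN hsum hF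
  have ha : ∀ n, N + 1 ≤ n → c n - Λ n = 0 := fun n hn => by rw [hNN n hn, sub_self]
  refine torusSum_le_half_of_re_le_half (fun n => c n - Λ n) (N + 1) hN1 ha (fun t => ?_) S hS φ
  have ht := hline t
  rw [Complex.re_sum] at ht
  calc ∑ n ∈ Finset.Ico 1 (N + 1), (c n - Λ n) / Real.sqrt n * Real.cos (Real.log n * t)
      = ∑ n ∈ Finset.Ico 1 (N + 1), ((((c n - Λ n : ℝ)) : ℂ) / (n : ℂ) ^ ((1 / 2 : ℂ) + t * I)).re := by
        refine Finset.sum_congr rfl fun n hn => ?_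
        rw [re_ofReal_div_natCast_cpow_half_add _ _ (Finset.mem_Ico.mp hn).1]
    _ ≤ 1 / 2 := ht

end Summit.RiemannHypothesis.RiemannHypothesis.Theorems.SignConeConeMagnification

end
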